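import Literature.Geometry.Kaehler.ComplexTorusEtaleAddHom
import Literature.Geometry.Kaehler.ComplexTorusSiegelNormalForm
import Literature.AlgebraicGeometry.HodgeTheory.AbelianVarietyHodgeFullnessHolds
import Literature.NumberTheory.Transcendental.AnalytificationUniquenessProofs
import Literature.AlgebraicGeometry.Motives.AbelianVarietyProofs
import HarnessLib

/-!
# An étale additive holomorphic map `ℂ^g → A(ℂ)` uniformises the complex abelian variety `A`

Lange–Birkenhake, *Complex Abelian Varieties*, Ch. 1 §1, Lemma 1.1.2 (proof) and Lemma 1.1.3 (a), (c): the exponential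
map `π : V = T₀X → X` of a complex torus ∕ complex abelian variety is the universal covering, a homomorphism whose
kernel is the period lattice; Mumford, *Abelian Varieties*, §1 (1)–(2).

`AbelianVariety.exists_complexTorus_of_etale_addHom` — for a complex abelian variety `A` of dimension `n` with an
analytification `φ : N → A(ℂ)` (holomorphic atlas), every map `h : ℂⁿ → A(ℂ)` which is ADDITIVE
(`h (z + w) = h z · h w`), HOLOMORPHIC (read in `N`), and INJECTIVE NEAR `0` is the universal covering: there is a
real frame `Φ : ℝ^{Fin n ⊕ Fin n} ≃ ℂⁿ` such that the fibres of `h` are the `Φ(ℤ^{2n})`-cosets, `h` is onto, and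
`h = φᵤ ∘ π_Φ` for an ADDITIVE ANALYTIFICATION `φᵤ : ComplexTorus Φ → A(ℂ)` — exactly the kernel ∕ surjectivity
clauses of ★ `IsRelExpChartOn` and the (group-law) clause (G) of ★ `relativeExponentialUniformisation` at ONE fibre
(organ E8-3 «FIBRE-HOM» of that fact's census).  Proof: ★ `complexAbelianVariety_torusUniformised_holds` makes
`A(ℂ)` a complex torus `X' = ComplexTorus Ψ`; by uniqueness of analytifications (★ `IsAnalytification.unique_holds`)
`h` read in `X'` is a continuous additive holomorphic map `ℂⁿ → X'`, injective near `0`, and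
★ `ComplexTorus.exists_frame_of_etale_addHom` re-frames it as the universal covering; the analytification
transports along the additive biholomorphism (★ `isAnalytification_comp_homeomorph`).

Everything is proved; no definitions, no named facts.  HC_CM is proved only modulo the 7 printed citations
(2 remaining: hLiu418 = stmt-HodgeConjecture-24832, h413 = stmt-HodgeConjecture-24833) until rung 0 closes;
count-neutral support toward ★ P-1.

## References

* [LangeBirkenhake1992] H. Lange, Ch. Birkenhake, *Complex Abelian Varieties* (1992), Ch. 1 §1 Lemma 1.1.2 (proof),
  Lemma 1.1.3 (a), (c) — held text `book:lange1992-complex-abelian-varieties` p0017.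
* [MumfordAV1970] D. Mumford, *Abelian Varieties* (1970), §1 (1)–(2).
* [SerreGAGA1956] J.-P. Serre, GAGA, §2 (unicité de `X^h`).
-/

noncomputable section

open scoped Manifold ContDiff Topology
open Set Function Filter
open Literature.Geometry.Kaehler (ComplexTorus isAnalytification_comp_homeomorph)
open Literature.Geometry.Kaehler.ComplexTorus (cover)
open Literature.NumberTheory.Transcendental (IsAnalytification)
open Literature.AlgebraicGeometry.HodgeTheory (complexAbelianVariety_torusUniformised_holds)

namespace Literature.AlgebraicGeometry.Motives

namespace AbelianVariety

/-- The rank clause: a real frame `Φ : ℝ^ι ≃ E` of a complex normed space has `card ι = 2 · dim_ℂ E` (a lattice in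
`ℂ^g` has rank `2g`). [cite: LangeBirkenhake1992, Ch. 1 §1 (definition of a lattice)] -/
private theorem frame_card_eq_two_mul_finrank' {ι : Type*} [Fintype ι] {E : Type*} [NormedAddCommGroup E]
    [NormedSpace ℂ E] (Φ : (ι → ℝ) ≃L[ℝ] E) : Fintype.card ι = 2 * Module.finrank ℂ E := by
  rw [← finrank_real_of_complex E, ← Φ.toLinearEquiv.finrank_eq, Module.finrank_fintype_fun_eq_card]

/-- **An étale additive holomorphic map `ℂⁿ → A(ℂ)` is the universal covering of the complex abelian variety `A`.**
For `A` of dimension `n`, an analytification `φ : N → A(ℂ)` with holomorphic atlas, and `h : ℂⁿ → A(ℂ)` additive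
(`h (z + w) = h z · h w`), holomorphic read in `N`, injective on a neighbourhood of `0`: there is a real frame
`Φ : ℝ^{Fin n ⊕ Fin n} ≃ ℂⁿ` with `h z = h z' ↔ z' ∈ z + Φ(ℤ^{2n})`, `h` onto, and `h = φᵤ ∘ π_Φ` for an additive
analytification `φᵤ : ComplexTorus Φ → A(ℂ)` («`π : V = T₀X → X` is the universal covering map … the exponential
map»; «`ker π` is a lattice»). [cite: LangeBirkenhake1992, Ch. 1 §1 Lemma 1.1.2 (proof) and Lemma 1.1.3 (a), (c)]
[cite: MumfordAV1970, §1 (1)–(2)] [cite: SerreGAGA1956, §2] -/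
theorem exists_complexTorus_of_etale_addHom (A : AbelianVariety ℂ) {n : ℕ} (hn : A.dim = n)
    {N : Type*} [TopologicalSpace N] [ChartedSpace (Fin n → ℂ) N] [IsManifold 𝓘(ℂ, Fin n → ℂ) ω N]
    {φ : N → ComplexPoints A.X} (hφ : IsAnalytification (Fin n → ℂ) A.X n φ)
    {h : (Fin n → ℂ) → ComplexPoints A.X} (hadd : ∀ z w, h (z + w) = h z * h w)
    (hhol : MDifferentiable 𝓘(ℂ, Fin n → ℂ) 𝓘(ℂ, Fin n → ℂ) (hφ.homeomorph.symm ∘ h))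
    {U : Set (Fin n → ℂ)} (hU : U ∈ 𝓝 (0 : Fin n → ℂ)) (hinj : U.InjOn h) :
    ∃ Φ : (Fin n ⊕ Fin n → ℝ) ≃L[ℝ] (Fin n → ℂ),
      (∀ z z', h z = h z' ↔ ∃ m : Fin n ⊕ Fin n → ℤ, z' = z + Φ (fun i ↦ (m i : ℝ))) ∧
      Surjective h ∧
      ∃ φu : ComplexTorus Φ → ComplexPoints A.X,
        IsAnalytification (Fin n → ℂ) A.X n φu ∧ (∀ x y, φu (x + y) = φu x * φu y) ∧
        ∀ z, h z = φu (cover Φ z) := by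
  classical
  subst hn
  obtain ⟨ι, _, _, Ψ, φ₀, hφ₀, hadd₀⟩ := complexAbelianVariety_torusUniformised_holds A
  -- `A(ℂ) ≅ ComplexTorus Ψ`; by uniqueness of analytifications `N ≅ ComplexTorus Ψ` biholomorphically over `A(ℂ)`
  haveI := A.smoothOfRelativeDimension_dim
  obtain ⟨g, hg, -, hgφ⟩ := IsAnalytification.unique_holds hφ hφ₀
  have hgφ' : ∀ m, φ₀ (g m) = φ m := fun m ↦ congrFun hgφ m
  -- `h` read in the torus
  set H : (Fin A.dim → ℂ) → ComplexTorus Ψ := fun z ↦ g (hφ.homeomorph.symm (h z)) with hH_def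
  have hH : ∀ z, φ₀ (H z) = h z := by
    intro z
    simp only [hH_def]
    rw [hgφ']
    have h1 := hφ.homeomorph.apply_symm_apply (h z)
    simpa only [IsAnalytification.coe_homeomorph] using h1
  have hHd : MDifferentiable 𝓘(ℂ, Fin A.dim → ℂ) 𝓘(ℂ, Fin A.dim → ℂ) H := hg.comp hhol
  have hφ₀inj : Injective φ₀ := hφ₀.isHomeomorph.injective
  have hHadd : ∀ z w, H (z + w) = H z + H w := by
    intro z w
    apply hφ₀inj
    rw [hadd₀, hH, hH, hH, hadd]
  have hHinj : U.InjOn H := fun z hz w hw hzw ↦ hinj hz hw (by rw [← hH, ← hH, hzw])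
  -- the re-indexing `Fin g ⊕ Fin g ≃ ι` (`card ι = 2 dim A`)
  have hcard : Fintype.card (Fin A.dim ⊕ Fin A.dim) = Fintype.card ι := by
    rw [frame_card_eq_two_mul_finrank' Ψ, Fintype.card_sum, Fintype.card_fin, Module.finrank_fintype_fun_eq_card,
      Fintype.card_fin, two_mul]
  let e : Fin A.dim ⊕ Fin A.dim ≃ ι := Fintype.equivOfCardEq hcard
  obtain ⟨Φ, T, hTadd, hTd, -, hT, hfib, hsurj⟩ :=
    ComplexTorus.exists_frame_of_etale_addHom e hHd.continuous hHadd (hHd 0) hU hHinj rfl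
  refine ⟨Φ, fun z z' ↦ ?_, fun y ↦ ?_, φ₀ ∘ T, ?_, fun x y ↦ ?_, fun z ↦ ?_⟩
  · rw [← hfib z z', ← hH, ← hH]
    exact ⟨fun h' ↦ hφ₀inj h', fun h' ↦ by rw [h']⟩
  · obtain ⟨z, hz⟩ := hsurj (hφ₀.homeomorph.symm y)
    refine ⟨z, ?_⟩
    rw [← hH, hz]
    simpa only [IsAnalytification.coe_homeomorph] using hφ₀.homeomorph.apply_symm_apply y
  · exact isAnalytification_comp_homeomorph hφ₀ T hTd (by simp)
  · simp only [comp_apply, hTadd, hadd₀]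
  · rw [comp_apply, hT, hH]

end AbelianVariety

end Literature.AlgebraicGeometry.Motives

end
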